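import Summits.QuantumFields.YangMills.Theorems.ColdStartUniversalityLatticeLangevinHypercontractivity
import Summits.QuantumFields.YangMills.Theorems.ColdStartUniversalityLatticeLangevinHypercontractivityConverse
import Summits.QuantumFields.YangMills.Theorems.ColdStartUniversalityLatticeLangevinHypercontractivityIffTools
import Summits.QuantumFields.YangMills.Theorems.ColdStartUniversalityLatticeLangevinFisherDissipation
import HarnessLib

/-!
# Route `ColdStartUniversality` (fixed-cut-off package, `Lᵖ` side): ★★★ GROSS'S EQUIVALENCE for the SZZ semigroup as a literal `Iff` —
# the generator-form LOG-SOBOLEV inequality on ALL `C³` cylinders ⟺ HYPERCONTRACTIVITY `‖κ_t G‖_{1+e^{4ρt}} ≤ ‖G‖₂` on positive cylinders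

Helper file (seat `ym-line-csu-p1`, g36; `--supports stmt-QuantumFields-24809`).  SU(2) lattice Langevin dynamics of Shen–Zhu–Zhu at
`(L, β')`, Wilson measure `μ = μ_{β'}`, ANY realising kernel family `κ`, constant `ρ ≥ 0`.  The forward direction is g36's
`lqNorm_transition_le_of_generatorLogSobolev` (`p = 2`); the converse `generatorLogSobolev_of_hypercontractive` (g36) gives the log-Sobolev
inequality only for POSITIVE COMPACTLY SUPPORTED `C³` cylinders.  This file removes both restrictions, so that the right-hand side is
literally the tree's hypothesis `hLSgen` (every `C³` function `f` of the real link coordinates):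

* (prequel `…HypercontractivityIffTools`: `exists_sqrt_sq_add_cylinder` — a `C³` compactly supported `g` with `g∘coords = √(F² + ε) > 0`
  and the CARRÉ DU CHAMP comparison `Γ(g)∘coords = (F²/(F²+ε))·Γ(f)∘coords ≤ Γ(f)∘coords`; `continuous_carre_coords`);
* ★★ `generatorLogSobolev_of_hypercontractive_all` — hypercontractivity on positive cylinders ⇒ `ρ·Ent(F²) ≤ −∫ F·𝓛f dμ` for EVERY `C³` `f`
  (the converse at `√(F²+ε)`, the energy identity `−∫ G·𝓛g = ½∫Γ(g)` (`two_mul_integral_mul_generator_eq_neg_carre`), `Γ(g) ≤ Γ(f)`,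
  and `ε ↓ 0` by uniform convergence of `(F²+ε)log(F²+ε)`);
* ★★★ `generatorLogSobolev_iff_hypercontractive` — THE EQUIVALENCE: `(∀ C³ f, ρ·Ent_μ(F²) ≤ −∫F·𝓛f dμ) ↔
  (∀ positive C³ compactly supported cylinders G, ∀ t, (∫(κ_tG)^{1+e^{4ρt}}dμ)^{1/(1+e^{4ρt})} ≤ (∫G² dμ)^{1/2})` — Gross 1975 /
  Diaconis–Saloff-Coste Thm 3.5 (i)+(ii), kernel-checked for this diffusion with no core or differentiability input.

THEOREMS ONLY, no definition, no sorry.  HONEST FRAMING: RECORD-rung R3 plumbing at FIXED cut-off; an equivalence of two functional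
inequalities with the same constant `ρ`, no cut-off-uniform content; no crux, rung or summit statement is proved; the Yang–Mills mass
gap is NOT proved.
-/

set_option autoImplicit false

noncomputable section

namespace Summit.QuantumFields.YangMills.Theorems.ColdStartUniversality

open MeasureTheory ProbabilityTheory Filter Set Topology
open scoped BigOperators NNReal ENNReal
open Literature.Probability.Process Literature.MathematicalPhysics.QuantumFieldTheory
open Literature.MathematicalPhysics.QuantumLattice (fundamentalRep fundamentalLatticeRep continuous_fundamentalRep)

variable {L : ℕ} [NeZero L]

/-! ## §1. Hypercontractivity ⇒ log-Sobolev on ALL `C³` cylinders -/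

/-- ★★ **Hypercontractivity ⇒ the generator-form log-Sobolev inequality on ALL `C³` cylinders.**  If the realising kernel family is
hypercontractive with exponent curve `1 + e^{4ρt}` on positive `C³` compactly supported cylinders (`ρ ≥ 0`), then EVERY `C³` function
`f` of the real link coordinates (any sign, any support) satisfies
`ρ·(∫ F² log F² dμ_{β'} − ∫F² dμ_{β'}·log ∫F² dμ_{β'}) ≤ −∫ F·𝓛f dμ_{β'}`, `F = f∘coords` — the statement `hLSgen` of the tree.
(The converse at the regularised cylinder `√(F²+ε)`, the energy identity, `Γ(√(f²+ε)) ≤ Γ(f)`, and `ε ↓ 0`.)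
[cite: DiaconisSaloffcoste1996, Theorem 3.5 (i)] -/
theorem generatorLogSobolev_of_hypercontractive_all (L : ℕ) [NeZero L] (β' : ℝ)
    (κ : ℝ≥0 → Kernel (GaugeConfig 3 L (Matrix.specialUnitaryGroup (Fin 2) ℂ))
      (GaugeConfig 3 L (Matrix.specialUnitaryGroup (Fin 2) ℂ))) [∀ t, IsMarkovKernel (κ t)]
    (hreal : ∀ (t : ℝ≥0) (x : GaugeConfig 3 L (Matrix.specialUnitaryGroup (Fin 2) ℂ))
        (Ω : Type) [MeasurableSpace Ω] (P : Measure Ω) [IsProbabilityMeasure P]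
        (W : ℝ≥0 → Ω → (Edge 3 L × NoiseIdx 2 → ℝ)) (hW : IsFlatBrownian W P)
        (U : ℝ≥0 → Ω → GaugeConfig 3 L (Matrix.specialUnitaryGroup (Fin 2) ℂ)),
        (∀ ω, U 0 ω = x) →
        (latticeLangevinDynamics (fundamentalLatticeRep 2) β').IsSolution (fundamentalRep (Fin 2))
          hW.natFiltration P W U →
        κ t x = P.map (U t))
    {ρ : ℝ} (hρ : 0 ≤ ρ)
    (hHC : ∀ (g : (Edge 3 L × Fin 2 × Fin 2 × Bool → ℝ) → ℝ), ContDiff ℝ 3 g → HasCompactSupport g →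
      (∀ x : GaugeConfig 3 L (Matrix.specialUnitaryGroup (Fin 2) ℂ),
        0 < g (fun q => (fun z : ℂ => if q.2.2.2 then z.im else z.re)
          ((fundamentalRep (Fin 2) (x q.1) : Matrix (Fin 2) (Fin 2) ℂ) q.2.1 q.2.2.1))) →
      ∀ t : ℝ≥0,
        (∫ x, (∫ y, g (fun q => (fun z : ℂ => if q.2.2.2 then z.im else z.re)
            ((fundamentalRep (Fin 2) (y q.1) : Matrix (Fin 2) (Fin 2) ℂ) q.2.1 q.2.2.1)) ∂(κ t x)) ^ (1 + Real.exp (4 * ρ * t))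
            ∂(wilsonMeasure (d := 3) (L := L) (fundamentalRep (Fin 2)) β')) ^ (1 / (1 + Real.exp (4 * ρ * t))) ≤
          (∫ x, g (fun q => (fun z : ℂ => if q.2.2.2 then z.im else z.re)
            ((fundamentalRep (Fin 2) (x q.1) : Matrix (Fin 2) (Fin 2) ℂ) q.2.1 q.2.2.1)) ^ (2 : ℝ)
            ∂(wilsonMeasure (d := 3) (L := L) (fundamentalRep (Fin 2)) β')) ^ (1 / (2 : ℝ)))
    {f : (Edge 3 L × Fin 2 × Fin 2 × Bool → ℝ) → ℝ} (hf : ContDiff ℝ 3 f) :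
    let coords : GaugeConfig 3 L (Matrix.specialUnitaryGroup (Fin 2) ℂ) → (Edge 3 L × Fin 2 × Fin 2 × Bool → ℝ) :=
      fun V q => (fun z : ℂ => if q.2.2.2 then z.im else z.re)
        ((fundamentalRep (Fin 2) (V q.1) : Matrix (Fin 2) (Fin 2) ℂ) q.2.1 q.2.2.1)
    let gen : GaugeConfig 3 L (Matrix.specialUnitaryGroup (Fin 2) ℂ) → ℝ := fun V =>
      (∑ i : Edge 3 L × Fin 2 × Fin 2 × Bool, fderiv ℝ f (coords V) (Pi.single i 1) *
          (fun z : ℂ => if i.2.2.2 then z.im else z.re)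
            ((latticeLangevinDynamics (fundamentalLatticeRep 2) β').drift
              (matrixConfig (fundamentalRep (Fin 2)) V) i.1 i.2.1 i.2.2.1) +
      1 / 2 * ∑ i : Edge 3 L × Fin 2 × Fin 2 × Bool, ∑ j : Edge 3 L × Fin 2 × Fin 2 × Bool,
        fderiv ℝ (fun z => fderiv ℝ f z (Pi.single i 1)) (coords V) (Pi.single j 1) *
          ∑ n : Edge 3 L × NoiseIdx 2,
            (if n.1 = i.1 then (fun z : ℂ => if i.2.2.2 then z.im else z.re)
              ((latticeLangevinDynamics (fundamentalLatticeRep 2) β').noise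
                (matrixConfig (fundamentalRep (Fin 2)) V) i.1 n.2 i.2.1 i.2.2.1) else 0) *
            (if n.1 = j.1 then (fun z : ℂ => if j.2.2.2 then z.im else z.re)
              ((latticeLangevinDynamics (fundamentalLatticeRep 2) β').noise
                (matrixConfig (fundamentalRep (Fin 2)) V) j.1 n.2 j.2.1 j.2.2.1) else 0))
    ρ * ((∫ V, f (coords V) ^ 2 * Real.log (f (coords V) ^ 2) ∂(wilsonMeasure (d := 3) (L := L) (fundamentalRep (Fin 2)) β')) -
        (∫ V, f (coords V) ^ 2 ∂(wilsonMeasure (d := 3) (L := L) (fundamentalRep (Fin 2)) β')) *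
          Real.log (∫ V, f (coords V) ^ 2 ∂(wilsonMeasure (d := 3) (L := L) (fundamentalRep (Fin 2)) β'))) ≤
      -∫ V, f (coords V) * gen V ∂(wilsonMeasure (d := 3) (L := L) (fundamentalRep (Fin 2)) β') := by
  intro coords gen
  classical
  haveI := secondCountableTopology_su2
  haveI := borelSpace_config L
  set μ : Measure (GaugeConfig 3 L (Matrix.specialUnitaryGroup (Fin 2) ℂ)) :=
    wilsonMeasure (d := 3) (L := L) (fundamentalRep (Fin 2)) β' with hμ
  haveI : IsProbabilityMeasure μ :=
    isProbabilityMeasure_wilsonMeasure (d := 3) (L := L) (fundamentalRep (Fin 2)) (continuous_fundamentalRep (Fin 2)) β'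
  have hco : Continuous coords := continuous_coords (L := L)
  set F : GaugeConfig 3 L (Matrix.specialUnitaryGroup (Fin 2) ℂ) → ℝ := fun V => f (coords V) with hF
  have hFc : Continuous F := hf.continuous.comp hco
  obtain ⟨B, -, hB⟩ := exists_abs_le_of_continuous hFc
  -- the noise matrix `A` and the carré du champ of `f`
  set A : GaugeConfig 3 L (Matrix.specialUnitaryGroup (Fin 2) ℂ) → (Edge 3 L × Fin 2 × Fin 2 × Bool) →
      (Edge 3 L × Fin 2 × Fin 2 × Bool) → ℝ := fun V i j =>
    ∑ n : Edge 3 L × NoiseIdx 2,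
      (if n.1 = i.1 then (fun z : ℂ => if i.2.2.2 then z.im else z.re)
        ((latticeLangevinDynamics (fundamentalLatticeRep 2) β').noise
          (matrixConfig (fundamentalRep (Fin 2)) V) i.1 n.2 i.2.1 i.2.2.1) else 0) *
      (if n.1 = j.1 then (fun z : ℂ => if j.2.2.2 then z.im else z.re)
        ((latticeLangevinDynamics (fundamentalLatticeRep 2) β').noise
          (matrixConfig (fundamentalRep (Fin 2)) V) j.1 n.2 j.2.1 j.2.2.1) else 0) with hA
  set Γf : GaugeConfig 3 L (Matrix.specialUnitaryGroup (Fin 2) ℂ) → ℝ := fun V =>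
    ∑ i : Edge 3 L × Fin 2 × Fin 2 × Bool, ∑ j : Edge 3 L × Fin 2 × Fin 2 × Bool,
      fderiv ℝ f (coords V) (Pi.single i 1) * fderiv ℝ f (coords V) (Pi.single j 1) * A V i j with hΓf
  have hΓfc : Continuous Γf := continuous_carre_coords L β' hf
  -- `−∫ F·gen = ½ ∫ Γ(f)` through a compactly supported copy `f₁` of `f`
  obtain ⟨f₁, hf₁, hf₁c, hf₁eq⟩ := exists_contDiff_hasCompactSupport_eqOn hf 1
  have hnear₁ : ∀ V : GaugeConfig 3 L (Matrix.specialUnitaryGroup (Fin 2) ℂ), f₁ =ᶠ[𝓝 (coords V)] f := fun V =>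
    hf₁eq _ (norm_coords_le_one V)
  have hval₁ : ∀ V, f₁ (coords V) = f (coords V) := fun V => (hnear₁ V).self_of_nhds
  have hfd₁ : ∀ V, fderiv ℝ f₁ (coords V) = fderiv ℝ f (coords V) := fun V => (hnear₁ V).fderiv_eq
  set gen₁ : GaugeConfig 3 L (Matrix.specialUnitaryGroup (Fin 2) ℂ) → ℝ := fun V =>
    (∑ i : Edge 3 L × Fin 2 × Fin 2 × Bool, fderiv ℝ f₁ (coords V) (Pi.single i 1) *
        (fun z : ℂ => if i.2.2.2 then z.im else z.re)
          ((latticeLangevinDynamics (fundamentalLatticeRep 2) β').drift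
            (matrixConfig (fundamentalRep (Fin 2)) V) i.1 i.2.1 i.2.2.1) +
    1 / 2 * ∑ i : Edge 3 L × Fin 2 × Fin 2 × Bool, ∑ j : Edge 3 L × Fin 2 × Fin 2 × Bool,
      fderiv ℝ (fun z => fderiv ℝ f₁ z (Pi.single i 1)) (coords V) (Pi.single j 1) * A V i j) with hgen₁
  have hgen₁eq : ∀ V, gen₁ V = gen V := fun V => generator_congr_of_eventuallyEq L β' V (hnear₁ V)
  have hEn₁ : 2 * ∫ V, f₁ (coords V) * gen₁ V ∂μ = -∫ V, (∑ i : Edge 3 L × Fin 2 × Fin 2 × Bool,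
      ∑ j : Edge 3 L × Fin 2 × Fin 2 × Bool, fderiv ℝ f₁ (coords V) (Pi.single i 1) * fderiv ℝ f₁ (coords V) (Pi.single j 1) *
        A V i j) ∂μ := two_mul_integral_mul_generator_eq_neg_carre L β' hf₁ hf₁c
  have hEnf : -∫ V, F V * gen V ∂μ = 1 / 2 * ∫ V, Γf V ∂μ := by
    have e1 : ∫ V, f₁ (coords V) * gen₁ V ∂μ = ∫ V, F V * gen V ∂μ :=
      integral_congr_ae (Eventually.of_forall fun V => by
        show f₁ (coords V) * gen₁ V = F V * gen V
        rw [hval₁, hgen₁eq])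
    have e2 : (∫ V, (∑ i : Edge 3 L × Fin 2 × Fin 2 × Bool, ∑ j : Edge 3 L × Fin 2 × Fin 2 × Bool,
        fderiv ℝ f₁ (coords V) (Pi.single i 1) * fderiv ℝ f₁ (coords V) (Pi.single j 1) * A V i j) ∂μ) = ∫ V, Γf V ∂μ :=
      integral_congr_ae (Eventually.of_forall fun V => by simp only [hΓf, hfd₁])
    rw [e1, e2] at hEn₁
    linarith
  -- ONE `ε`: the converse at the regularised cylinder `g_ε`
  have hstep : ∀ ε : ℝ, 0 < ε →
      ρ * ((∫ V, (F V ^ 2 + ε) * Real.log (F V ^ 2 + ε) ∂μ) - (∫ V, (F V ^ 2 + ε) ∂μ) * Real.log (∫ V, (F V ^ 2 + ε) ∂μ)) ≤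
        -∫ V, F V * gen V ∂μ := by
    intro ε hε
    obtain ⟨g, hg, hgc, hgval, hgpos, -, hΓle⟩ := exists_sqrt_sq_add_cylinder L β' hf hε
    set geng : GaugeConfig 3 L (Matrix.specialUnitaryGroup (Fin 2) ℂ) → ℝ := fun V =>
      (∑ i : Edge 3 L × Fin 2 × Fin 2 × Bool, fderiv ℝ g (coords V) (Pi.single i 1) *
          (fun z : ℂ => if i.2.2.2 then z.im else z.re)
            ((latticeLangevinDynamics (fundamentalLatticeRep 2) β').drift
              (matrixConfig (fundamentalRep (Fin 2)) V) i.1 i.2.1 i.2.2.1) +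
      1 / 2 * ∑ i : Edge 3 L × Fin 2 × Fin 2 × Bool, ∑ j : Edge 3 L × Fin 2 × Fin 2 × Bool,
        fderiv ℝ (fun z => fderiv ℝ g z (Pi.single i 1)) (coords V) (Pi.single j 1) * A V i j) with hgeng
    -- the converse for `g`
    have hLSg : ρ * ((∫ V, g (coords V) ^ 2 * Real.log (g (coords V) ^ 2) ∂μ) -
        (∫ V, g (coords V) ^ 2 ∂μ) * Real.log (∫ V, g (coords V) ^ 2 ∂μ)) ≤ -∫ V, g (coords V) * geng V ∂μ :=
      generatorLogSobolev_of_hypercontractive L β' κ hreal hρ hHC hg hgc hgpos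
    -- the energy identity for `g` and `Γ(g) ≤ Γ(f)`
    have hEng : 2 * ∫ V, g (coords V) * geng V ∂μ = -∫ V, (∑ i : Edge 3 L × Fin 2 × Fin 2 × Bool,
        ∑ j : Edge 3 L × Fin 2 × Fin 2 × Bool, fderiv ℝ g (coords V) (Pi.single i 1) * fderiv ℝ g (coords V) (Pi.single j 1) *
          A V i j) ∂μ := two_mul_integral_mul_generator_eq_neg_carre L β' hg hgc
    have hΓgc : Continuous fun V => ∑ i : Edge 3 L × Fin 2 × Fin 2 × Bool, ∑ j : Edge 3 L × Fin 2 × Fin 2 × Bool,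
        fderiv ℝ g (coords V) (Pi.single i 1) * fderiv ℝ g (coords V) (Pi.single j 1) * A V i j := continuous_carre_coords L β' hg
    have hΓint : (∫ V, (∑ i : Edge 3 L × Fin 2 × Fin 2 × Bool, ∑ j : Edge 3 L × Fin 2 × Fin 2 × Bool,
        fderiv ℝ g (coords V) (Pi.single i 1) * fderiv ℝ g (coords V) (Pi.single j 1) * A V i j) ∂μ) ≤ ∫ V, Γf V ∂μ :=
      integral_mono (integrable_of_continuous_of_compactSpace hΓgc μ) (integrable_of_continuous_of_compactSpace hΓfc μ)
        fun V => hΓle V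
    -- `g(coords V)² = F V² + ε`
    have hg2 : ∀ V, g (coords V) ^ 2 = F V ^ 2 + ε := fun V => by
      rw [hgval]; exact Real.sq_sqrt (by positivity)
    simp only [hg2] at hLSg
    linarith
  -- `ε ↓ 0`: uniform convergence of `(F² + ε) log(F² + ε)` (clamped parametrisation `ε ↦ max 0 (min ε 1)`)
  set w : ℝ → GaugeConfig 3 L (Matrix.specialUnitaryGroup (Fin 2) ℂ) → ℝ := fun ε V => F V ^ 2 + max 0 (min ε 1) with hw
  have hclamp : ∀ ε : ℝ, 0 ≤ max 0 (min ε 1) ∧ max 0 (min ε 1) ≤ 1 := fun ε =>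
    ⟨le_max_left _ _, max_le zero_le_one (min_le_right _ _)⟩
  have hwm : ∀ ε, AEStronglyMeasurable (w ε) μ := fun ε => ((hFc.pow 2).add continuous_const).aestronglyMeasurable
  have hw₀m : AEStronglyMeasurable (fun V => F V ^ 2) μ := (hFc.pow 2).aestronglyMeasurable
  have hF2b : ∀ V, F V ^ 2 ≤ B ^ 2 := fun V => by
    have := hB V; rw [← sq_abs]; exact pow_le_pow_left₀ (abs_nonneg _) this 2
  have hR : ∀ ε V, |w ε V| ≤ B ^ 2 + 1 := fun ε V => by
    rw [hw, abs_of_nonneg (by nlinarith [sq_nonneg (F V), (hclamp ε).1])]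
    linarith [hF2b V, (hclamp ε).2]
  have hR₀ : ∀ V, |F V ^ 2| ≤ B ^ 2 + 1 := fun V => by rw [abs_of_nonneg (sq_nonneg _)]; linarith [hF2b V]
  have hU : TendstoUniformly w (fun V => F V ^ 2) (𝓝[>] (0 : ℝ)) := by
    rw [Metric.tendstoUniformly_iff]
    intro δ hδ
    filter_upwards [Ioo_mem_nhdsGT (lt_min hδ one_pos)] with ε hε V
    obtain ⟨hε0, hε1⟩ := hε
    have hε1' : ε < 1 := lt_of_lt_of_le hε1 (min_le_right _ _)
    have hεδ : ε < δ := lt_of_lt_of_le hε1 (min_le_left _ _)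
    have e : max 0 (min ε 1) = ε := by rw [min_eq_left hε1'.le, max_eq_right hε0.le]
    rw [hw, Real.dist_eq]; simp only [e]
    rw [show F V ^ 2 - (F V ^ 2 + ε) = -ε by ring, abs_neg, abs_of_pos hε0]
    exact hεδ
  have T1 := EntropyFlow.tendsto_integral_comp_of_tendstoUniformly (ν := μ) hwm hw₀m hR hR₀ hU Real.continuous_mul_log
  have T2 := EntropyFlow.tendsto_integral_comp_of_tendstoUniformly (ν := μ) hwm hw₀m hR hR₀ hU continuous_id
  simp only [id] at T2
  have T3 := (Real.continuous_mul_log.tendsto _).comp T2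
  have Tall : Tendsto (fun ε => ρ * ((∫ V, w ε V * Real.log (w ε V) ∂μ) - (∫ V, w ε V ∂μ) * Real.log (∫ V, w ε V ∂μ)))
      (𝓝[>] (0 : ℝ)) (𝓝 (ρ * ((∫ V, F V ^ 2 * Real.log (F V ^ 2) ∂μ) - (∫ V, F V ^ 2 ∂μ) * Real.log (∫ V, F V ^ 2 ∂μ)))) :=
    (T1.sub T3).const_mul ρ
  have hev : ∀ᶠ ε in 𝓝[>] (0 : ℝ), ρ * ((∫ V, w ε V * Real.log (w ε V) ∂μ) - (∫ V, w ε V ∂μ) * Real.log (∫ V, w ε V ∂μ)) ≤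
      -∫ V, F V * gen V ∂μ := by
    filter_upwards [Ioo_mem_nhdsGT one_pos] with ε hε
    have e : max 0 (min ε 1) = ε := by rw [min_eq_left hε.2.le, max_eq_right hε.1.le]
    simp only [hw, e]
    exact hstep ε hε.1
  exact le_of_tendsto Tall hev

/-! ## §2. The equivalence -/

/-- ★★★ **GROSS'S EQUIVALENCE for the SZZ semigroup at a fixed cut-off.**  For every `L`, `β'`, every realising kernel family `κ`
and every `ρ ≥ 0`, the following are EQUIVALENT:
(i) the generator-form LOG-SOBOLEV inequality `ρ·(∫ F² log F² dμ_{β'} − ∫F² dμ_{β'}·log ∫F² dμ_{β'}) ≤ −∫ F·𝓛f dμ_{β'}` for every `C³`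
function `f` of the real link coordinates (`F = f∘coords`; the hypothesis `hLSgen` of the tree's entropy package);
(ii) HYPERCONTRACTIVITY: `(∫ (κ_t G)^{1+e^{4ρt}} dμ_{β'})^{1/(1+e^{4ρt})} ≤ (∫ G² dμ_{β'})^{1/2}` for every positive `C³` compactly
supported cylinder `G` and every `t ≥ 0`.
((i)⇒(ii): `lqNorm_transition_le_of_generatorLogSobolev`, `p = 2`; (ii)⇒(i): `generatorLogSobolev_of_hypercontractive_all`.)  With the
tree's constants: (i), hence (ii), holds with `ρ = ½e^{−4|β'|#𝒫}` at every `(L, β')` and with `ρ = (1−12|β'|)/2` for `|β'| < 1/12`.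
[cite: DiaconisSaloffcoste1996, Theorem 3.5] -/
theorem generatorLogSobolev_iff_hypercontractive (L : ℕ) [NeZero L] (β' : ℝ)
    (κ : ℝ≥0 → Kernel (GaugeConfig 3 L (Matrix.specialUnitaryGroup (Fin 2) ℂ))
      (GaugeConfig 3 L (Matrix.specialUnitaryGroup (Fin 2) ℂ))) [∀ t, IsMarkovKernel (κ t)]
    (hreal : ∀ (t : ℝ≥0) (x : GaugeConfig 3 L (Matrix.specialUnitaryGroup (Fin 2) ℂ))
        (Ω : Type) [MeasurableSpace Ω] (P : Measure Ω) [IsProbabilityMeasure P]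
        (W : ℝ≥0 → Ω → (Edge 3 L × NoiseIdx 2 → ℝ)) (hW : IsFlatBrownian W P)
        (U : ℝ≥0 → Ω → GaugeConfig 3 L (Matrix.specialUnitaryGroup (Fin 2) ℂ)),
        (∀ ω, U 0 ω = x) →
        (latticeLangevinDynamics (fundamentalLatticeRep 2) β').IsSolution (fundamentalRep (Fin 2))
          hW.natFiltration P W U →
        κ t x = P.map (U t))
    {ρ : ℝ} (hρ : 0 ≤ ρ) :
    (∀ (f : (Edge 3 L × Fin 2 × Fin 2 × Bool → ℝ) → ℝ), ContDiff ℝ 3 f →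
        let coords : GaugeConfig 3 L (Matrix.specialUnitaryGroup (Fin 2) ℂ) → (Edge 3 L × Fin 2 × Fin 2 × Bool → ℝ) :=
          fun V q => (fun z : ℂ => if q.2.2.2 then z.im else z.re)
            ((fundamentalRep (Fin 2) (V q.1) : Matrix (Fin 2) (Fin 2) ℂ) q.2.1 q.2.2.1)
        let gen : GaugeConfig 3 L (Matrix.specialUnitaryGroup (Fin 2) ℂ) → ℝ := fun V =>
          (∑ i : Edge 3 L × Fin 2 × Fin 2 × Bool, fderiv ℝ f (coords V) (Pi.single i 1) *
              (fun z : ℂ => if i.2.2.2 then z.im else z.re)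
                ((latticeLangevinDynamics (fundamentalLatticeRep 2) β').drift
                  (matrixConfig (fundamentalRep (Fin 2)) V) i.1 i.2.1 i.2.2.1) +
          1 / 2 * ∑ i : Edge 3 L × Fin 2 × Fin 2 × Bool, ∑ j : Edge 3 L × Fin 2 × Fin 2 × Bool,
            fderiv ℝ (fun z => fderiv ℝ f z (Pi.single i 1)) (coords V) (Pi.single j 1) *
              ∑ n : Edge 3 L × NoiseIdx 2,
                (if n.1 = i.1 then (fun z : ℂ => if i.2.2.2 then z.im else z.re)
                  ((latticeLangevinDynamics (fundamentalLatticeRep 2) β').noise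
                    (matrixConfig (fundamentalRep (Fin 2)) V) i.1 n.2 i.2.1 i.2.2.1) else 0) *
                (if n.1 = j.1 then (fun z : ℂ => if j.2.2.2 then z.im else z.re)
                  ((latticeLangevinDynamics (fundamentalLatticeRep 2) β').noise
                    (matrixConfig (fundamentalRep (Fin 2)) V) j.1 n.2 j.2.1 j.2.2.1) else 0))
        ρ * ((∫ V, f (coords V) ^ 2 * Real.log (f (coords V) ^ 2) ∂(wilsonMeasure (d := 3) (L := L) (fundamentalRep (Fin 2)) β')) -
            (∫ V, f (coords V) ^ 2 ∂(wilsonMeasure (d := 3) (L := L) (fundamentalRep (Fin 2)) β')) *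
              Real.log (∫ V, f (coords V) ^ 2 ∂(wilsonMeasure (d := 3) (L := L) (fundamentalRep (Fin 2)) β'))) ≤
          -∫ V, f (coords V) * gen V ∂(wilsonMeasure (d := 3) (L := L) (fundamentalRep (Fin 2)) β')) ↔
    (∀ (g : (Edge 3 L × Fin 2 × Fin 2 × Bool → ℝ) → ℝ), ContDiff ℝ 3 g → HasCompactSupport g →
      (∀ x : GaugeConfig 3 L (Matrix.specialUnitaryGroup (Fin 2) ℂ),
        0 < g (fun q => (fun z : ℂ => if q.2.2.2 then z.im else z.re)
          ((fundamentalRep (Fin 2) (x q.1) : Matrix (Fin 2) (Fin 2) ℂ) q.2.1 q.2.2.1))) →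
      ∀ t : ℝ≥0,
        (∫ x, (∫ y, g (fun q => (fun z : ℂ => if q.2.2.2 then z.im else z.re)
            ((fundamentalRep (Fin 2) (y q.1) : Matrix (Fin 2) (Fin 2) ℂ) q.2.1 q.2.2.1)) ∂(κ t x)) ^ (1 + Real.exp (4 * ρ * t))
            ∂(wilsonMeasure (d := 3) (L := L) (fundamentalRep (Fin 2)) β')) ^ (1 / (1 + Real.exp (4 * ρ * t))) ≤
          (∫ x, g (fun q => (fun z : ℂ => if q.2.2.2 then z.im else z.re)
            ((fundamentalRep (Fin 2) (x q.1) : Matrix (Fin 2) (Fin 2) ℂ) q.2.1 q.2.2.1)) ^ (2 : ℝ)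
            ∂(wilsonMeasure (d := 3) (L := L) (fundamentalRep (Fin 2)) β')) ^ (1 / (2 : ℝ))) := by
  constructor
  · intro hLS g hg hgc hgpos t
    have h := lqNorm_transition_le_of_generatorLogSobolev L β' κ hreal hρ hLS hg hgc hgpos (p := 2) one_lt_two t
    have e : 1 + ((2 : ℝ) - 1) * Real.exp (4 * ρ * t) = 1 + Real.exp (4 * ρ * t) := by ring
    simp only [e] at h
    exact h
  · intro hHC f hf
    exact generatorLogSobolev_of_hypercontractive_all L β' κ hreal hρ hHC hf

end Summit.QuantumFields.YangMills.Theorems.ColdStartUniversality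

end
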